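import Literature.Claims.NS.Wu2026
import Literature.Analysis.FunctionSpaces.WeakLpQuantitative
import Mathlib.MeasureTheory.Measure.Lebesgue.EqHaar
import HarnessLib

/-!
# C177 `Wu2026` — SALVAGE, TRUE column: (3.4)–(3.8) PROVED — logarithmic growth of the cumulative
# strong `L^{9/5}` vorticity mass from `ω ∈ L^{9/5,∞} ∩ L²` (D-0090 NS-CLAIMS, LADDER row rung 3;
# salvage seat `ns-claims-salvage-p3`)

Kernel proof of the binder `Literature.Claims.NS.Wu2026.Step_38` of `claim_of_steps''` (skeleton
p558978 / rev 2 p560520, typist-10 g6), EXACTLY as typed: for a smooth steady flow `(v, p)` with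
`ω = curl v ∈ L^{9/5,∞}(ℝ³)`, `D(v) < ∞` and `‖ω‖²_{L²} = D` ((3.3)), the dyadic masses
`a_k = ∫_{A_{2^k}} |ω|^{9/5}` ((3.7)) satisfy `Σ_{k=0}^{N} a_k ≤ C₀(N + 1)` for all `N` ((3.8)).

The print derives (3.8) from the three-regime layer-cake estimate (3.4)–(3.6) p.7 l.30 – p.8 l.49:
«µ_E(λ) ≤ min{|E|, M^{9/5}λ^{−9/5}, Dλ^{−2}} (3.4) … For small λ we use the volume bound, for
intermediate λ the weak endpoint bound M, and for large λ the L² bound D … ∫_E |ω|^{9/5} dx ≤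
C_{M,D}(1 + log(2 + |E|)) (3.6) … then (3.6), applied to B_{2^{N+1}} ∖ B_1, implies Σ_{k=0}^{N} a_k ≤
C₀(N + 1) (3.8)». Here the intermediate regime is summed over DYADIC AMPLITUDE LEVELS instead of
integrated (`lintegral_level_le`: each level `{c/2 < |ω| ≤ c}` costs `2^{9/5}‖ω‖^{9/5}_{L^{9/5,∞}}` by
Chebyshev, tree `meas_lt_norm_le_eWeakLpPow_mul_ofReal_rpow_neg`; `lintegral_middle_le`: `m` levels),
the volume regime is `lintegral_low_le`, the `L²` regime above amplitude `1` is `lintegral_high_le`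
(`|ω|^{9/5} ≤ |ω|²` there), assembled in `lintegral_three_regime`; on `E = B_{2^{N+1}}` with `m = 5(N+1)`
levels the volume term is `2^{−6(N+1)}|B₁| ≤ |B₁|` (`low_regime_ball_le`), and
`Σ_{k≤N} a_k ≤ ∫_{B_{2^{N+1}}}|ω|^{9/5}` by disjointness of the annuli (`sum_dyMass_le_integral_ball`), whence
`step_38` with `C₀ = |B₁| + D + 5·2^{9/5}‖ω‖^{9/5}_{L^{9/5,∞}}`. Standard axioms; no definition.
Companions: `SoloSalvageWu2026.lean` (Lemma 3.1), `…Flux.lean` ((3.86)–(3.87)), `…Annulus.lean` ((3.18)).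

WHAT THIS IS NOT: not a claim about NS regularity or blow-up; not a claim about any author beyond the
typed locator.
-/

noncomputable section

set_option linter.dupNamespace false

open MeasureTheory Set Function Filter Topology Metric
open scoped ENNReal NNReal RealInnerProductSpace

namespace Summit.NavierStokesRegularity.NavierStokesRegularity.Theorems.Wu2026Salvage

open Literature.Analysis.FluidPDE Literature.Analysis.FunctionSpaces Literature.Claims.NS.Wu2026

/-! ### Three-regime estimate for a continuous field `ω ∈ L^{9/5,∞}` with `|ω|² ∈ L¹` ((3.4)–(3.6)) -/

section ThreeRegime

variable {ω : E3 → E3}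

/-- `(9/5 : ℝ≥0∞).toReal = 9/5`. [cite: Wu2026, (3.1) p.7] -/
theorem toReal_nine_fifths : ((9 : ℝ≥0∞) / 5).toReal = (9 : ℝ) / 5 := by
  rw [ENNReal.toReal_div]; norm_num

/-- `‖ω x‖ₑ ^ r = ofReal (‖ω x‖ ^ r)` for `r ≥ 0`. [folklore] -/
theorem enorm_rpow_eq_ofReal (x : E3) {r : ℝ} (hr : 0 ≤ r) :
    ‖ω x‖ₑ ^ r = ENNReal.ofReal (‖ω x‖ ^ r) := by
  rw [← ofReal_norm, ENNReal.ofReal_rpow_of_nonneg (norm_nonneg _) hr]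

/-- The amplitude level set `{c/2 < |ω| ≤ c}` is measurable for continuous `ω`. [folklore] -/
theorem measurableSet_level (hω : Continuous ω) (a b : ℝ) :
    MeasurableSet {x : E3 | a < ‖ω x‖ ∧ ‖ω x‖ ≤ b} :=
  (measurableSet_lt measurable_const hω.norm.measurable).inter
    (measurableSet_le hω.norm.measurable measurable_const)

/-- **One dyadic amplitude level** (the weak-`L^{9/5}` regime of (3.4)–(3.5)): on `E ∩ {c/2 < |ω| ≤ c}`,
`∫ |ω|^{9/5} ≤ c^{9/5} · μ{|ω| > c/2} ≤ c^{9/5}(c/2)^{−9/5} W = 2^{9/5} W`, `W = ‖ω‖^{9/5}_{L^{9/5,∞}}`.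
[cite: Wu2026, (3.4)–(3.5) p.7 l.37–52] -/
theorem lintegral_level_le (hω : Continuous ω) {c : ℝ} (hc : 0 < c) {E : Set E3}
    (hE : MeasurableSet E) :
    ∫⁻ x in E ∩ {x | c / 2 < ‖ω x‖ ∧ ‖ω x‖ ≤ c}, ‖ω x‖ₑ ^ ((9 : ℝ) / 5) ≤
      ENNReal.ofReal ((2 : ℝ) ^ ((9 : ℝ) / 5)) * eWeakLpPow ω ((9 : ℝ≥0∞) / 5) volume := by
  set L : Set E3 := {x | c / 2 < ‖ω x‖ ∧ ‖ω x‖ ≤ c} with hL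
  set W : ℝ≥0∞ := eWeakLpPow ω ((9 : ℝ≥0∞) / 5) volume with hW
  have hr : (0 : ℝ) ≤ 9 / 5 := by norm_num
  have hLm : MeasurableSet L := measurableSet_level hω _ _
  -- pointwise bound `‖ω‖ₑ^r ≤ ofReal (c^r)` on the level set
  have h1 : ∫⁻ x in E ∩ L, ‖ω x‖ₑ ^ ((9 : ℝ) / 5) ≤ ∫⁻ _ in E ∩ L, ENNReal.ofReal (c ^ ((9 : ℝ) / 5)) := by
    refine setLIntegral_mono' (hE.inter hLm) fun x hx => ?_
    rw [enorm_rpow_eq_ofReal x hr]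
    exact ENNReal.ofReal_le_ofReal (Real.rpow_le_rpow (norm_nonneg _) hx.2.2 hr)
  -- measure of the level set by Chebyshev at height `c/2`
  have h2 : volume (E ∩ L) ≤ W * ENNReal.ofReal ((c / 2) ^ (-((9 : ℝ) / 5))) := by
    have hsub : E ∩ L ⊆ {x | c / 2 < ‖ω x‖} := fun x hx => hx.2.1
    have hcheb := meas_lt_norm_le_eWeakLpPow_mul_ofReal_rpow_neg ω ((9 : ℝ≥0∞) / 5) volume
      (half_pos hc)
    rw [toReal_nine_fifths] at hcheb
    exact (measure_mono hsub).trans hcheb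
  -- the constants combine to `2^{9/5}`
  have hconst : c ^ ((9 : ℝ) / 5) * (c / 2) ^ (-((9 : ℝ) / 5)) = (2 : ℝ) ^ ((9 : ℝ) / 5) := by
    rw [Real.rpow_neg (by positivity), ← div_eq_mul_inv, ← Real.div_rpow hc.le (by positivity)]
    congr 1
    field_simp
  calc ∫⁻ x in E ∩ L, ‖ω x‖ₑ ^ ((9 : ℝ) / 5)
      ≤ ∫⁻ _ in E ∩ L, ENNReal.ofReal (c ^ ((9 : ℝ) / 5)) := h1
    _ = ENNReal.ofReal (c ^ ((9 : ℝ) / 5)) * volume (E ∩ L) := setLIntegral_const _ _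
    _ ≤ ENNReal.ofReal (c ^ ((9 : ℝ) / 5)) * (W * ENNReal.ofReal ((c / 2) ^ (-((9 : ℝ) / 5)))) :=
        mul_le_mul' le_rfl h2
    _ = ENNReal.ofReal (c ^ ((9 : ℝ) / 5) * (c / 2) ^ (-((9 : ℝ) / 5))) * W := by
        rw [ENNReal.ofReal_mul (by positivity)]
        ring
    _ = ENNReal.ofReal ((2 : ℝ) ^ ((9 : ℝ) / 5)) * W := by rw [hconst]

/-- **The logarithmic middle regime**, summed over `m` dyadic levels `(1/2)^m < |ω| ≤ 1`:
`∫_{E ∩ {2^{−m} < |ω| ≤ 1}} |ω|^{9/5} ≤ m · 2^{9/5} W` (each level contributes `2^{9/5}W`; this is the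
`log` of (3.6) with levels in place of the continuous layer-cake integral). [cite: Wu2026, (3.5)–(3.6) p.7 l.45 – p.8 l.20] -/
theorem lintegral_middle_le (hω : Continuous ω) {E : Set E3} (hE : MeasurableSet E) (m : ℕ) :
    ∫⁻ x in E ∩ {x | ((1 : ℝ) / 2) ^ m < ‖ω x‖ ∧ ‖ω x‖ ≤ 1}, ‖ω x‖ₑ ^ ((9 : ℝ) / 5) ≤
      (m : ℝ≥0∞) * (ENNReal.ofReal ((2 : ℝ) ^ ((9 : ℝ) / 5)) * eWeakLpPow ω ((9 : ℝ≥0∞) / 5) volume) := by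
  induction m with
  | zero =>
    have hempty : E ∩ {x : E3 | ((1 : ℝ) / 2) ^ 0 < ‖ω x‖ ∧ ‖ω x‖ ≤ 1} = ∅ := by
      ext x
      simp only [pow_zero, mem_inter_iff, mem_setOf_eq, mem_empty_iff_false, iff_false, not_and,
        not_le]
      intro _ h1
      exact h1
    rw [hempty, Measure.restrict_empty, lintegral_zero_measure]
    simp
  | succ m ih =>
    set c : ℝ := ((1 : ℝ) / 2) ^ m with hc
    have hc0 : 0 < c := by positivity
    have hsucc : ((1 : ℝ) / 2) ^ (m + 1) = c / 2 := by rw [pow_succ, hc]; ring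
    -- the new level plus the previous ones
    have hsub : E ∩ {x : E3 | ((1 : ℝ) / 2) ^ (m + 1) < ‖ω x‖ ∧ ‖ω x‖ ≤ 1} ⊆
        (E ∩ {x | c / 2 < ‖ω x‖ ∧ ‖ω x‖ ≤ c}) ∪ (E ∩ {x | ((1 : ℝ) / 2) ^ m < ‖ω x‖ ∧ ‖ω x‖ ≤ 1}) := by
      intro x hx
      rw [hsucc] at hx
      by_cases h : ‖ω x‖ ≤ c
      · exact Or.inl ⟨hx.1, hx.2.1, h⟩
      · exact Or.inr ⟨hx.1, by rw [← hc]; exact not_le.1 h, hx.2.2⟩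
    calc ∫⁻ x in E ∩ {x : E3 | ((1 : ℝ) / 2) ^ (m + 1) < ‖ω x‖ ∧ ‖ω x‖ ≤ 1}, ‖ω x‖ₑ ^ ((9 : ℝ) / 5)
        ≤ ∫⁻ x in (E ∩ {x | c / 2 < ‖ω x‖ ∧ ‖ω x‖ ≤ c}) ∪
            (E ∩ {x | ((1 : ℝ) / 2) ^ m < ‖ω x‖ ∧ ‖ω x‖ ≤ 1}), ‖ω x‖ₑ ^ ((9 : ℝ) / 5) :=
          lintegral_mono_set hsub
      _ ≤ (∫⁻ x in E ∩ {x | c / 2 < ‖ω x‖ ∧ ‖ω x‖ ≤ c}, ‖ω x‖ₑ ^ ((9 : ℝ) / 5)) +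
            ∫⁻ x in E ∩ {x | ((1 : ℝ) / 2) ^ m < ‖ω x‖ ∧ ‖ω x‖ ≤ 1}, ‖ω x‖ₑ ^ ((9 : ℝ) / 5) :=
          lintegral_union_le _ _ _
      _ ≤ ENNReal.ofReal ((2 : ℝ) ^ ((9 : ℝ) / 5)) * eWeakLpPow ω ((9 : ℝ≥0∞) / 5) volume +
            (m : ℝ≥0∞) * (ENNReal.ofReal ((2 : ℝ) ^ ((9 : ℝ) / 5)) *
              eWeakLpPow ω ((9 : ℝ≥0∞) / 5) volume) :=
          add_le_add (lintegral_level_le hω hc0 hE) ih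
      _ = ((m + 1 : ℕ) : ℝ≥0∞) * (ENNReal.ofReal ((2 : ℝ) ^ ((9 : ℝ) / 5)) *
            eWeakLpPow ω ((9 : ℝ≥0∞) / 5) volume) := by
          push_cast
          ring

/-- **The small-amplitude regime** (volume bound of (3.4)): on `E ∩ {|ω| ≤ c}`, `∫ |ω|^{9/5} ≤ c^{9/5}|E|`.
[cite: Wu2026, (3.4) p.7 l.37–44] -/
theorem lintegral_low_le (hω : Continuous ω) {c : ℝ} (_hc : 0 ≤ c) {E : Set E3} (hE : MeasurableSet E) :
    ∫⁻ x in E ∩ {x | ‖ω x‖ ≤ c}, ‖ω x‖ₑ ^ ((9 : ℝ) / 5) ≤ ENNReal.ofReal (c ^ ((9 : ℝ) / 5)) * volume E := by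
  have hr : (0 : ℝ) ≤ 9 / 5 := by norm_num
  have hm : MeasurableSet (E ∩ {x | ‖ω x‖ ≤ c}) :=
    hE.inter (measurableSet_le hω.norm.measurable measurable_const)
  calc ∫⁻ x in E ∩ {x | ‖ω x‖ ≤ c}, ‖ω x‖ₑ ^ ((9 : ℝ) / 5)
      ≤ ∫⁻ _ in E ∩ {x | ‖ω x‖ ≤ c}, ENNReal.ofReal (c ^ ((9 : ℝ) / 5)) := by
        refine setLIntegral_mono' hm fun x hx => ?_
        rw [enorm_rpow_eq_ofReal x hr]
        exact ENNReal.ofReal_le_ofReal (Real.rpow_le_rpow (norm_nonneg _) hx.2 hr)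
    _ = ENNReal.ofReal (c ^ ((9 : ℝ) / 5)) * volume (E ∩ {x | ‖ω x‖ ≤ c}) := setLIntegral_const _ _
    _ ≤ ENNReal.ofReal (c ^ ((9 : ℝ) / 5)) * volume E :=
        mul_le_mul' le_rfl (measure_mono inter_subset_left)

/-- **The large-amplitude regime** (the `L²` bound of (3.4)): on `{|ω| > 1}`, `|ω|^{9/5} ≤ |ω|²`, so
`∫_{E ∩ {|ω|>1}} |ω|^{9/5} ≤ ∫ |ω|²`. [cite: Wu2026, (3.4) p.7 l.37–44; p.8 l.1–12] -/
theorem lintegral_high_le (hω : Continuous ω) (E : Set E3) :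
    ∫⁻ x in E ∩ {x | 1 < ‖ω x‖}, ‖ω x‖ₑ ^ ((9 : ℝ) / 5) ≤ ∫⁻ x, ENNReal.ofReal (‖ω x‖ ^ 2) := by
  have hm : MeasurableSet {x : E3 | 1 < ‖ω x‖} := measurableSet_lt measurable_const hω.norm.measurable
  calc ∫⁻ x in E ∩ {x | 1 < ‖ω x‖}, ‖ω x‖ₑ ^ ((9 : ℝ) / 5)
      ≤ ∫⁻ x in {x | 1 < ‖ω x‖}, ‖ω x‖ₑ ^ ((9 : ℝ) / 5) := lintegral_mono_set inter_subset_right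
    _ ≤ ∫⁻ x in {x | 1 < ‖ω x‖}, ENNReal.ofReal (‖ω x‖ ^ 2) := by
        refine setLIntegral_mono' hm fun x hx => ?_
        have hx' : 1 < ‖ω x‖ := hx
        have h1 : (1 : ℝ≥0∞) ≤ ‖ω x‖ₑ := by
          rw [← ofReal_norm]; exact ENNReal.one_le_ofReal.2 hx'.le
        calc ‖ω x‖ₑ ^ ((9 : ℝ) / 5) ≤ ‖ω x‖ₑ ^ (2 : ℝ) :=
              ENNReal.rpow_le_rpow_of_exponent_le h1 (by norm_num)
          _ = ENNReal.ofReal (‖ω x‖ ^ 2) := by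
              rw [enorm_rpow_eq_ofReal x (by norm_num : (0 : ℝ) ≤ 2), Real.rpow_two]
    _ ≤ ∫⁻ x, ENNReal.ofReal (‖ω x‖ ^ 2) := setLIntegral_le_lintegral _ _

/-- **(3.6), discrete form**: for a continuous `ω`, every measurable `E` and every `m`,
`∫_E |ω|^{9/5} ≤ 2^{−9m/5}|E| + m·2^{9/5}‖ω‖^{9/5}_{L^{9/5,∞}} + ‖ω‖²_{L²}` — the volume, weak and `L²`
regimes of (3.4). [cite: Wu2026, (3.4)–(3.6) p.7 l.37 – p.8 l.20] -/
theorem lintegral_three_regime (hω : Continuous ω) {E : Set E3} (hE : MeasurableSet E) (m : ℕ) :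
    ∫⁻ x in E, ‖ω x‖ₑ ^ ((9 : ℝ) / 5) ≤
      ENNReal.ofReal ((((1 : ℝ) / 2) ^ m) ^ ((9 : ℝ) / 5)) * volume E +
        (m : ℝ≥0∞) * (ENNReal.ofReal ((2 : ℝ) ^ ((9 : ℝ) / 5)) * eWeakLpPow ω ((9 : ℝ≥0∞) / 5) volume) +
        ∫⁻ x, ENNReal.ofReal (‖ω x‖ ^ 2) := by
  set c : ℝ := ((1 : ℝ) / 2) ^ m with hc
  have hsub : E ⊆ (E ∩ {x | ‖ω x‖ ≤ c}) ∪ (E ∩ {x | ((1 : ℝ) / 2) ^ m < ‖ω x‖ ∧ ‖ω x‖ ≤ 1}) ∪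
      (E ∩ {x | 1 < ‖ω x‖}) := by
    intro x hx
    by_cases h1 : ‖ω x‖ ≤ c
    · exact Or.inl (Or.inl ⟨hx, h1⟩)
    · by_cases h2 : ‖ω x‖ ≤ 1
      · exact Or.inl (Or.inr ⟨hx, by rw [← hc]; exact not_le.1 h1, h2⟩)
      · exact Or.inr ⟨hx, not_le.1 h2⟩
  calc ∫⁻ x in E, ‖ω x‖ₑ ^ ((9 : ℝ) / 5)
      ≤ ∫⁻ x in (E ∩ {x | ‖ω x‖ ≤ c}) ∪ (E ∩ {x | ((1 : ℝ) / 2) ^ m < ‖ω x‖ ∧ ‖ω x‖ ≤ 1}) ∪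
          (E ∩ {x | 1 < ‖ω x‖}), ‖ω x‖ₑ ^ ((9 : ℝ) / 5) := lintegral_mono_set hsub
    _ ≤ (∫⁻ x in (E ∩ {x | ‖ω x‖ ≤ c}) ∪ (E ∩ {x | ((1 : ℝ) / 2) ^ m < ‖ω x‖ ∧ ‖ω x‖ ≤ 1}),
            ‖ω x‖ₑ ^ ((9 : ℝ) / 5)) +
          ∫⁻ x in E ∩ {x | 1 < ‖ω x‖}, ‖ω x‖ₑ ^ ((9 : ℝ) / 5) := lintegral_union_le _ _ _
    _ ≤ ((∫⁻ x in E ∩ {x | ‖ω x‖ ≤ c}, ‖ω x‖ₑ ^ ((9 : ℝ) / 5)) +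
          ∫⁻ x in E ∩ {x | ((1 : ℝ) / 2) ^ m < ‖ω x‖ ∧ ‖ω x‖ ≤ 1}, ‖ω x‖ₑ ^ ((9 : ℝ) / 5)) +
          ∫⁻ x in E ∩ {x | 1 < ‖ω x‖}, ‖ω x‖ₑ ^ ((9 : ℝ) / 5) :=
        add_le_add (lintegral_union_le _ _ _) le_rfl
    _ ≤ ENNReal.ofReal (c ^ ((9 : ℝ) / 5)) * volume E +
          (m : ℝ≥0∞) * (ENNReal.ofReal ((2 : ℝ) ^ ((9 : ℝ) / 5)) *
            eWeakLpPow ω ((9 : ℝ≥0∞) / 5) volume) +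
          ∫⁻ x, ENNReal.ofReal (‖ω x‖ ^ 2) :=
        add_le_add (add_le_add (lintegral_low_le hω (by positivity) hE)
          (lintegral_middle_le hω hE m)) (lintegral_high_le hω E)

end ThreeRegime

/-! ### The dyadic masses of a smooth steady flow: `Σ_{k≤N} a_k ≤ C₀(N+1)` ((3.7)–(3.8)) -/

/-- The exponent-`9/5` modulus of the vorticity is continuous for a smooth velocity. [folklore] -/
theorem continuous_norm_curl_rpow {v : E3 → E3} (hv : ContDiff ℝ (⊤ : ℕ∞) v) :
    Continuous fun x => ‖curl v x‖ ^ ((9 : ℝ) / 5) :=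
  ((continuous_curl (hv.of_le (by exact_mod_cast le_top))).norm).rpow_const
    fun _ => Or.inr (by norm_num)

/-- `|∇v|^{9/5}` is integrable on every ball (continuity). [folklore] -/
theorem integrableOn_norm_curl_rpow_ball {v : E3 → E3} (hv : ContDiff ℝ (⊤ : ℕ∞) v) (R : ℝ) :
    IntegrableOn (fun x => ‖curl v x‖ ^ ((9 : ℝ) / 5)) (ball (0 : E3) R) :=
  ((continuous_norm_curl_rpow hv).continuousOn.integrableOn_compact
    (isCompact_closedBall (0 : E3) R)).mono_set ball_subset_closedBall

/-- **The cumulative dyadic mass is an integral over one ball**: `Σ_{k=0}^{N} a_k ≤ ∫_{B_{2^{N+1}}}|ω|^{9/5}`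
(the annuli `A_{2^k}`, `k ≤ N`, are disjoint and lie in `B_{2^{N+1}}`; (3.8) applies (3.6) to
`B_{2^{N+1}} ∖ B_1`). [cite: Wu2026, (3.7)–(3.8) p.8 l.36–49] -/
theorem sum_dyMass_le_integral_ball {v : E3 → E3} (hv : ContDiff ℝ (⊤ : ℕ∞) v) (N : ℕ) :
    ∑ k ∈ Finset.range (N + 1), dyMass v k ≤
      ∫ x in ball (0 : E3) ((2 : ℝ) ^ (N + 1)), ‖curl v x‖ ^ ((9 : ℝ) / 5) := by
  have hnn : ∀ x : E3, 0 ≤ ‖curl v x‖ ^ ((9 : ℝ) / 5) := fun x => by positivity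
  induction N with
  | zero =>
    rw [zero_add, Finset.sum_range_one, dyMass, pow_zero]
    refine setIntegral_mono_set (integrableOn_norm_curl_rpow_ball hv _)
      (Eventually.of_forall hnn) (Eventually.of_forall ?_)
    intro x hx
    have h2 : ‖x‖ < 2 * 1 := hx.2
    exact mem_ball_zero_iff.2 (by norm_num at h2 ⊢; exact h2)
  | succ N ih =>
    rw [Finset.sum_range_succ]
    have hdisj : Disjoint (ball (0 : E3) ((2 : ℝ) ^ (N + 1))) (annulus ((2 : ℝ) ^ (N + 1))) := by
      rw [Set.disjoint_left]
      intro x hx hx'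
      rw [mem_ball_zero_iff] at hx
      exact lt_irrefl _ (hx.trans hx'.1)
    have hA : MeasurableSet (annulus ((2 : ℝ) ^ (N + 1))) :=
      (measurableSet_lt measurable_const continuous_norm.measurable).inter
        (measurableSet_lt continuous_norm.measurable measurable_const)
    have hIA : IntegrableOn (fun x => ‖curl v x‖ ^ ((9 : ℝ) / 5)) (annulus ((2 : ℝ) ^ (N + 1))) :=
      (integrableOn_norm_curl_rpow_ball hv (2 * (2 : ℝ) ^ (N + 1))).mono_set fun x hx => by
        rw [mem_ball_zero_iff]; exact hx.2
    have hunion : ball (0 : E3) ((2 : ℝ) ^ (N + 1)) ∪ annulus ((2 : ℝ) ^ (N + 1)) ⊆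
        ball (0 : E3) ((2 : ℝ) ^ (N + 1 + 1)) := by
      intro x hx
      rw [mem_ball_zero_iff]
      have h2 : (2 : ℝ) ^ (N + 1 + 1) = 2 * (2 : ℝ) ^ (N + 1) := by ring
      rcases hx with hx | hx
      · rw [mem_ball_zero_iff] at hx
        have : (0 : ℝ) < (2 : ℝ) ^ (N + 1) := by positivity
        linarith
      · rw [h2]; exact hx.2
    calc ∑ k ∈ Finset.range (N + 1), dyMass v k + dyMass v (N + 1)
        ≤ (∫ x in ball (0 : E3) ((2 : ℝ) ^ (N + 1)), ‖curl v x‖ ^ ((9 : ℝ) / 5)) +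
            ∫ x in annulus ((2 : ℝ) ^ (N + 1)), ‖curl v x‖ ^ ((9 : ℝ) / 5) :=
          add_le_add ih le_rfl
      _ = ∫ x in ball (0 : E3) ((2 : ℝ) ^ (N + 1)) ∪ annulus ((2 : ℝ) ^ (N + 1)),
            ‖curl v x‖ ^ ((9 : ℝ) / 5) :=
          (setIntegral_union hdisj hA (integrableOn_norm_curl_rpow_ball hv _) hIA).symm
      _ ≤ ∫ x in ball (0 : E3) ((2 : ℝ) ^ (N + 1 + 1)), ‖curl v x‖ ^ ((9 : ℝ) / 5) :=
          setIntegral_mono_set (integrableOn_norm_curl_rpow_ball hv _) (Eventually.of_forall hnn)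
            (Eventually.of_forall hunion)

/-- The volume regime is harmless on `B_{2^{N+1}}` with `5(N+1)` dyadic levels:
`(2^{−5(N+1)})^{9/5} |B_{2^{N+1}}| = 2^{−6(N+1)}|B₁| ≤ |B₁|`. [cite: Wu2026, (3.6) p.7–8 (choice of λ₀ = M|E|^{−5/9})] -/
theorem low_regime_ball_le (N : ℕ) :
    ENNReal.ofReal ((((1 : ℝ) / 2) ^ ((N + 1) * 5)) ^ ((9 : ℝ) / 5)) *
        volume (ball (0 : E3) ((2 : ℝ) ^ (N + 1))) ≤ volume (ball (0 : E3) 1) := by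
  set a : ℝ := ((1 : ℝ) / 2) ^ (N + 1) with ha
  have ha0 : 0 < a := by positivity
  have hpow : (((1 : ℝ) / 2) ^ ((N + 1) * 5)) ^ ((9 : ℝ) / 5) = a ^ 9 := by
    rw [pow_mul, ← ha, ← Real.rpow_natCast a 5, ← Real.rpow_mul ha0.le]
    norm_num
  rw [hpow, Measure.addHaar_ball_of_pos volume (0 : E3) (by positivity : (0 : ℝ) < 2 ^ (N + 1)),
    finrank_euclideanSpace, Fintype.card_fin, ← mul_assoc, ← ENNReal.ofReal_mul (by positivity)]
  have hle : a ^ 9 * ((2 : ℝ) ^ (N + 1)) ^ 3 ≤ 1 := by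
    rw [ha, one_div_pow, one_div_pow, div_mul_eq_mul_div, one_mul, div_le_one (by positivity)]
    exact pow_le_pow_right₀ (one_le_pow₀ (by norm_num)) (by norm_num)
  calc ENNReal.ofReal (a ^ 9 * ((2 : ℝ) ^ (N + 1)) ^ 3) * volume (ball (0 : E3) 1)
      ≤ ENNReal.ofReal 1 * volume (ball (0 : E3) 1) := mul_le_mul' (ENNReal.ofReal_le_ofReal hle) le_rfl
    _ = volume (ball (0 : E3) 1) := by rw [ENNReal.ofReal_one, one_mul]

/-- **(3.6) ⟹ (3.8) PROVED** — the typed binder `Step_38`: for a smooth steady flow with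
`ω = curl v ∈ L^{9/5,∞}` and `‖ω‖²_{L²} = D < ∞`, the dyadic masses `a_k = ∫_{A_{2^k}}|ω|^{9/5}` obey
`Σ_{k=0}^{N} a_k ≤ C₀(N+1)` with `C₀ = |B₁| + D + 5·2^{9/5}‖ω‖^{9/5}_{L^{9/5,∞}}` (volume regime on
`B_{2^{N+1}}` with `5(N+1)` dyadic amplitude levels, each level costing `2^{9/5}‖ω‖^{9/5}_{L^{9/5,∞}}`, and the
`L²` regime above amplitude `1`). [cite: Wu2026, (3.4)–(3.8) p.7 l.30 – p.8 l.49] -/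
theorem step_38 : Step_38 := by
  intro ν hν v p hflow hD h33
  set ω : E3 → E3 := curl v with hω
  have hωc : Continuous ω := continuous_curl (hflow.smooth_v.of_le (by exact_mod_cast le_top))
  set W : ℝ≥0∞ := eWeakLpPow ω ((9 : ℝ≥0∞) / 5) volume with hW
  have hWfin : W < ∞ := hflow.weakVort.2
  have hV1 : volume (ball (0 : E3) 1) < ∞ := measure_ball_lt_top
  set C0 : ℝ := (volume (ball (0 : E3) 1)).toReal + (dirichlet v).toReal +
    5 * ((2 : ℝ) ^ ((9 : ℝ) / 5) * W.toReal) with hC0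
  refine ⟨C0, fun N => ?_⟩
  -- the three-regime bound on the ball `B_{2^{N+1}}` with `m = 5(N+1)` levels
  have hE : MeasurableSet (ball (0 : E3) ((2 : ℝ) ^ (N + 1))) := measurableSet_ball
  have h3 := lintegral_three_regime hωc hE ((N + 1) * 5)
  have hsq : ∫⁻ x, ENNReal.ofReal (‖ω x‖ ^ 2) = dirichlet v := h33
  rw [hsq] at h3
  -- bound the three terms by finite constants
  have hbound : ∫⁻ x in ball (0 : E3) ((2 : ℝ) ^ (N + 1)), ‖ω x‖ₑ ^ ((9 : ℝ) / 5) ≤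
      volume (ball (0 : E3) 1) +
        (((N + 1) * 5 : ℕ) : ℝ≥0∞) * (ENNReal.ofReal ((2 : ℝ) ^ ((9 : ℝ) / 5)) * W) + dirichlet v :=
    h3.trans (add_le_add (add_le_add (low_regime_ball_le N) le_rfl) le_rfl)
  have hfin : volume (ball (0 : E3) 1) +
      (((N + 1) * 5 : ℕ) : ℝ≥0∞) * (ENNReal.ofReal ((2 : ℝ) ^ ((9 : ℝ) / 5)) * W) + dirichlet v ≠ ∞ := by
    have h1 : ENNReal.ofReal ((2 : ℝ) ^ ((9 : ℝ) / 5)) * W ≠ ∞ :=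
      ENNReal.mul_ne_top ENNReal.ofReal_ne_top hWfin.ne
    have h2 : (((N + 1) * 5 : ℕ) : ℝ≥0∞) * (ENNReal.ofReal ((2 : ℝ) ^ ((9 : ℝ) / 5)) * W) ≠ ∞ :=
      ENNReal.mul_ne_top (ENNReal.natCast_ne_top _) h1
    exact ENNReal.add_ne_top.2 ⟨ENNReal.add_ne_top.2 ⟨hV1.ne, h2⟩, hD.ne⟩
  -- pass to real numbers
  have hreal : ∫ x in ball (0 : E3) ((2 : ℝ) ^ (N + 1)), ‖ω x‖ ^ ((9 : ℝ) / 5) ≤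
      (volume (ball (0 : E3) 1)).toReal +
        ((N + 1) * 5 : ℕ) * ((2 : ℝ) ^ ((9 : ℝ) / 5) * W.toReal) + (dirichlet v).toReal := by
    rw [integral_eq_lintegral_of_nonneg_ae (Eventually.of_forall fun x => by positivity)
      (continuous_norm_curl_rpow hflow.smooth_v).aestronglyMeasurable.restrict]
    have hcongr : ∫⁻ x in ball (0 : E3) ((2 : ℝ) ^ (N + 1)), ENNReal.ofReal (‖ω x‖ ^ ((9 : ℝ) / 5)) =
        ∫⁻ x in ball (0 : E3) ((2 : ℝ) ^ (N + 1)), ‖ω x‖ₑ ^ ((9 : ℝ) / 5) :=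
      lintegral_congr fun x => (enorm_rpow_eq_ofReal x (by norm_num)).symm
    rw [hcongr]
    refine (ENNReal.toReal_mono hfin hbound).trans (le_of_eq ?_)
    have h1 : ENNReal.ofReal ((2 : ℝ) ^ ((9 : ℝ) / 5)) * W ≠ ∞ :=
      ENNReal.mul_ne_top ENNReal.ofReal_ne_top hWfin.ne
    have h2 : (((N + 1) * 5 : ℕ) : ℝ≥0∞) * (ENNReal.ofReal ((2 : ℝ) ^ ((9 : ℝ) / 5)) * W) ≠ ∞ :=
      ENNReal.mul_ne_top (ENNReal.natCast_ne_top _) h1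
    rw [ENNReal.toReal_add (ENNReal.add_ne_top.2 ⟨hV1.ne, h2⟩) hD.ne,
      ENNReal.toReal_add hV1.ne h2, ENNReal.toReal_mul, ENNReal.toReal_mul,
      ENNReal.toReal_ofReal (by positivity), ENNReal.toReal_natCast]
  -- conclude
  calc ∑ k ∈ Finset.range (N + 1), dyMass v k
      ≤ ∫ x in ball (0 : E3) ((2 : ℝ) ^ (N + 1)), ‖curl v x‖ ^ ((9 : ℝ) / 5) :=
        sum_dyMass_le_integral_ball hflow.smooth_v N
    _ ≤ (volume (ball (0 : E3) 1)).toReal +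
        ((N + 1) * 5 : ℕ) * ((2 : ℝ) ^ ((9 : ℝ) / 5) * W.toReal) + (dirichlet v).toReal := hreal
    _ ≤ C0 * (N + 1) := by
        rw [hC0]
        have hN : (1 : ℝ) ≤ (N : ℝ) + 1 := by
          have : (0 : ℝ) ≤ N := Nat.cast_nonneg N
          linarith
        have hV0 : 0 ≤ (volume (ball (0 : E3) 1)).toReal := ENNReal.toReal_nonneg
        have hD0 : 0 ≤ (dirichlet v).toReal := ENNReal.toReal_nonneg
        have hK0 : 0 ≤ (2 : ℝ) ^ ((9 : ℝ) / 5) * W.toReal := by positivity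
        push_cast
        nlinarith

end Summit.NavierStokesRegularity.NavierStokesRegularity.Theorems.Wu2026Salvage

end

-- WHAT THIS IS NOT: not a claim about NS regularity or blow-up; not a claim about any author beyond the typed locator.
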